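import Summits.Ventures.Crystal3D.Theorems.StickyWulffConstantGenericWallFloorTubeCountChain
import Summits.Ventures.Crystal3D.Theorems.StickyWulffConstantGenericWallFloorChainTerminalClass
import Summits.Ventures.Crystal3D.Theorems.StickyWulffConstantGenericWallFloorGeneralRungTubesSF
import Summits.Ventures.Crystal3D.Theorems.StickyWulffConstantCoaxialWallLawCreditLedger
import HarnessLib

/-!
# The general-filling rung for ALL non-co-axial pairs (chain pairs included), with an `h`-dependent charge

HONEST FRAMING. Venture `Summits/Ventures/Crystal3D` (cell `crystal3d-full`), helper for the crux
`GenericWallFloor` (stmt-Ventures-19480) of `route-Ventures-StickyWulffConstant`, REGISTERED line `WallLedgerG`,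
open stub `stub_twoSlabAdhesion : TwoSlabAdhesion` (THE CRUX of the line).  Rung credit only; F-C1 not moved.

**Theorem (`general_twoSlabAdhesion_hcharge_of_not_coaxial`).**  Inputs `KissingGap δ`, `KissingClassification δ`
BY NAME (tree theorems at `δ = 5/2`).  For EVERY pair `(A₁, t₁, A₂, t₂)` satisfying the crux's non-co-axiality
hypothesis VERBATIM there are `κ > 0` (depending on `A₂` only: `κ = δ₀(A₂)/16 000 000` with the tilt modulus
of `exists_terminalClass`), `C` and `R₀ = 20` such that for every `h ≥ 0`, `ρ ≥ 20`, every `1`-separated `X`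
in the cell with the clamped samples `P₁ ⊆ Λ₁`, `P₂ ⊆ Λ₂` — EXACTLY the hypothesis list of `stub_twoSlabAdhesion`,
ARBITRARY filling —
`cross(P₁, X∖P₁) + cross(P₂, (X∖P₁)∖P₂) ≤ D((X∖P₁)∖P₂) + (φ₁ + φ₂)·π·ρ² − (κ/(1+h))·ρ² + C·(1 + h)·ρ`.
So the wall between ANY two non-co-axial grains, of thickness `h`, costs at least `κρ²/(1+h)` whatever fills it:
no non-co-axial pair admits a free wall at bounded thickness.  For the `Σ3ⁿ` chain pairs (the family left open
by `general_twoSlabAdhesion_nonTriadic_sf`, which keeps the `h`-free `(2/2809)ρ²` for all other pairs) this is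
the first general-filling rung; the decay in `h` is genuine for the method (a coherent facet of in-plane width
`(h + 4R₀)/sin θ` swallows `O(width)` tubes per unit length against `O(1)` boundary payers) and consistent with
cf-p1 §78 (the double-twin-lamella escape makes the stub's `h`-term necessary for chain pairs).

PROOF = ARCH v4 for chain pairs: `exists_terminalClass` (class `𝓣`, modulus `δ₀`, `A₁ ∉ 𝓣` from
non-co-axiality) + `card_chainPayers_ge_sf` (`(2m+1)² ≤ (169K + 170)·#payers`, `K = ⌈(h+63)/δ₀⌉`, axes on the
`37`-grid of radius `ρ − 23 − K`) + `interior_ledger_ge_faces_add_unsaturated` (outer faces + payers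
`≤ Σ(12 − deg)`) + `affineSampleDeficit_upper` + the deficiency splits.
WHAT THIS IS NOT: not the stub — the charge is `κ/(1+h)`, not `1·π`; F-C1 not moved.
-/

noncomputable section

namespace Summit.Ventures.Crystal3D.Theorems

open Summit.Ventures.Crystal3D Finset
open Literature.MathematicalPhysics.StatisticalMechanics (fccStacking contactDeficiency IsHaggSeq barlowStacking)
open scoped InnerProductSpace

set_option maxHeartbeats 400000 in
open scoped Classical in
/-- **The general-filling rung for all non-co-axial pairs, `h`-dependent charge.**  See the module docstring. -/
theorem general_twoSlabAdhesion_hcharge_of_not_coaxial {δ : ℝ} (hg : KissingGap δ) (hc : KissingClassification δ)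
    (A₁ : EuclideanSpace ℝ (Fin 3) ≃ₗᵢ[ℝ] EuclideanSpace ℝ (Fin 3)) (t₁ : EuclideanSpace ℝ (Fin 3))
    (A₂ : EuclideanSpace ℝ (Fin 3) ≃ₗᵢ[ℝ] EuclideanSpace ℝ (Fin 3)) (t₂ : EuclideanSpace ℝ (Fin 3))
    (hnc : ¬ ∃ (L : EuclideanSpace ℝ (Fin 3) ≃ₗᵢ[ℝ] EuclideanSpace ℝ (Fin 3))
        (s₁ s₂ : EuclideanSpace ℝ (Fin 3)) (σ σ' : ℤ → ℤ), IsHaggSeq σ ∧ IsHaggSeq σ' ∧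
        (fun p => A₁ p + t₁) '' fccStacking 1 (Real.sqrt (2 / 3)) ⊆
          (fun p => L p + s₁) '' barlowStacking 1 (Real.sqrt (2 / 3)) σ ∧
        (fun p => A₂ p + t₂) '' fccStacking 1 (Real.sqrt (2 / 3)) ⊆
          (fun p => L p + s₂) '' barlowStacking 1 (Real.sqrt (2 / 3)) σ') :
    ∃ κ : ℝ, 0 < κ ∧ ∃ C R₀ : ℝ, 1 ≤ R₀ ∧ ∀ h : ℝ, 0 ≤ h → ∀ ρ : ℝ, R₀ ≤ ρ →
      ∀ X P₁ P₂ : Finset (EuclideanSpace ℝ (Fin 3)),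
      (∀ p ∈ X, ∀ q ∈ X, p ≠ q → 1 ≤ dist p q) → P₁ ⊆ X → P₂ ⊆ X \ P₁ →
      (∀ p ∈ X, -(2 * R₀) ≤ p 2 ∧ p 2 ≤ h + 2 * R₀ ∧ p 0 ^ 2 + p 1 ^ 2 ≤ ρ ^ 2) →
      (∀ p, p ∈ P₁ ↔ (p ∈ (fun q => A₁ q + t₁) '' fccStacking 1 (Real.sqrt (2 / 3)) ∧
        -(2 * R₀) ≤ p 2 ∧ p 2 ≤ -R₀ ∧ p 0 ^ 2 + p 1 ^ 2 ≤ ρ ^ 2)) →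
      (∀ p, p ∈ P₂ ↔ (p ∈ (fun q => A₂ q + t₂) '' fccStacking 1 (Real.sqrt (2 / 3)) ∧
        h + R₀ ≤ p 2 ∧ p 2 ≤ h + 2 * R₀ ∧ p 0 ^ 2 + p 1 ^ 2 ≤ ρ ^ 2)) →
      ((((P₁ ×ˢ (X \ P₁)).filter fun pq => dist pq.1 pq.2 = 1).card : ℕ) : ℝ) +
        ((((P₂ ×ˢ ((X \ P₁) \ P₂)).filter fun pq => dist pq.1 pq.2 = 1).card : ℕ) : ℝ) ≤
        contactDeficiency ((X \ P₁) \ P₂) +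
          (Real.sqrt 2 / 4 * ∑ᶠ w ∈ {w ∈ fccStacking 1 (Real.sqrt (2 / 3)) | ‖w‖ = 1},
              |⟪w, A₁.symm (EuclideanSpace.single (2 : Fin 3) (1 : ℝ))⟫_ℝ| +
            Real.sqrt 2 / 4 * ∑ᶠ w ∈ {w ∈ fccStacking 1 (Real.sqrt (2 / 3)) | ‖w‖ = 1},
              |⟪w, A₂.symm (EuclideanSpace.single (2 : Fin 3) (1 : ℝ))⟫_ℝ|) * Real.pi * ρ ^ 2 -
          κ / (1 + h) * ρ ^ 2 + C * (1 + h) * ρ := by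
  obtain ⟨𝓣, δ₀, hδ₀, hδ₀1, hA₁, hT, hTh, hδ⟩ := exists_terminalClass A₁ t₁ A₂ t₂ hnc
  obtain ⟨C₁, hC₁⟩ := affineSampleDeficit_upper A₁ t₁ 20 (by norm_num)
  obtain ⟨C₂, hC₂⟩ := affineSampleDeficit_upper A₂ t₂ 20 (by norm_num)
  refine ⟨δ₀ / 16000000, by positivity, (240 * Real.sqrt 2 * Real.pi + 3120 * (4 * 20 + 2)) / 2 + 2 + |C₁| + |C₂|,
    20, by norm_num, ?_⟩
  intro h hh ρ hρ X P₁ P₂ hX hP₁X hP₂X hcell hP₁ hP₂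
  set φ₁ : ℝ := Real.sqrt 2 / 4 * ∑ᶠ w ∈ {w ∈ fccStacking 1 (Real.sqrt (2 / 3)) | ‖w‖ = 1},
      |⟪w, A₁.symm (EuclideanSpace.single (2 : Fin 3) (1 : ℝ))⟫_ℝ| with hφ₁
  set φ₂ : ℝ := Real.sqrt 2 / 4 * ∑ᶠ w ∈ {w ∈ fccStacking 1 (Real.sqrt (2 / 3)) | ‖w‖ = 1},
      |⟪w, A₂.symm (EuclideanSpace.single (2 : Fin 3) (1 : ℝ))⟫_ℝ| with hφ₂
  have hP₂X' : P₂ ⊆ X := hP₂X.trans Finset.sdiff_subset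
  have hρ0 : (0 : ℝ) ≤ ρ := by linarith
  have hh1 : (0 : ℝ) < 1 + h := by linarith
  -- the interior ledger with the payer window `[−22, h + 24]`
  have hled := interior_ledger_ge_faces_add_unsaturated A₁ t₁ A₂ t₂ X P₁ P₂ 20 h ρ (by norm_num) hh hρ hX hcell
    hP₁X hP₂X' hP₁ hP₂ (fun y => -(20 : ℝ) - 2 ≤ y 2 ∧ y 2 ≤ h + 20 + 4)
    (by intro y _ hy _; exact ⟨by linarith [hy.1], by linarith [hy.2]⟩)
  rw [← finsum_unit_fcc_symm_eq_sum_slots A₁, ← finsum_unit_fcc_symm_eq_sum_slots A₂, ← hφ₁, ← hφ₂] at hled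
  simp only [] at hled
  set PAY := X.filter fun x => (X.filter fun q => dist x q = 1).card ≠ 12 ∧ -(20 : ℝ) - 2 ≤ x 2 ∧ x 2 ≤ h + 20 + 4
    with hPAY
  have hP0 : (0 : ℝ) ≤ (PAY.card : ℝ) := Nat.cast_nonneg _
  -- the charge
  have hcharge : δ₀ / 16000000 / (1 + h) * ρ ^ 2 ≤ (PAY.card : ℝ) / 2 + 2 * (1 + h) * ρ := by
    rw [div_mul_eq_mul_div, div_le_iff₀ hh1, div_mul_eq_mul_div, div_le_iff₀ (by norm_num : (0 : ℝ) < 16000000)]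
    have hexp : ((PAY.card : ℝ) / 2 + 2 * (1 + h) * ρ) * (1 + h) * 16000000 =
        8000000 * ((1 + h) * (PAY.card : ℝ)) + 32000000 * ρ + 64000000 * (h * ρ) + 32000000 * (h * h * ρ) := by
      ring
    rw [hexp]
    have hhP : (0 : ℝ) ≤ (1 + h) * (PAY.card : ℝ) := mul_nonneg hh1.le hP0
    have hhρ : (0 : ℝ) ≤ h * ρ := mul_nonneg hh hρ0
    have hhhρ : (0 : ℝ) ≤ h * h * ρ := mul_nonneg (mul_nonneg hh hh) hρ0
    set K : ℕ := ⌈(h + 63) / δ₀⌉₊ with hKdef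
    have hK : h + 3 * 20 + 3 ≤ (K : ℝ) * δ₀ := by
      have h1 : (h + 63) / δ₀ ≤ K := Nat.le_ceil _
      rw [div_le_iff₀ hδ₀] at h1; linarith
    have hKδ : (K : ℝ) * δ₀ ≤ h + 64 := by
      have h0 : (0 : ℝ) ≤ (h + 63) / δ₀ := by positivity
      have h1 : (K : ℝ) < (h + 63) / δ₀ + 1 := Nat.ceil_lt_add_one h0
      have h2 : (K : ℝ) * δ₀ < ((h + 63) / δ₀ + 1) * δ₀ := mul_lt_mul_of_pos_right h1 hδ₀
      rw [add_mul, div_mul_cancel₀ _ hδ₀.ne', one_mul] at h2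
      linarith
    have hK0 : (0 : ℝ) ≤ K := Nat.cast_nonneg K
    by_cases hρK : (K : ℝ) + 50 ≤ ρ
    · set m : ℕ := ⌊(ρ - 23 - K) / 53⌋₊ with hmdef
      have hm0 : (0 : ℝ) ≤ (ρ - 23 - K) / 53 := by apply div_nonneg <;> linarith
      have hmle : (m : ℝ) ≤ (ρ - 23 - K) / 53 := Nat.floor_le hm0
      have hmlt : (ρ - 23 - K) / 53 < (m : ℝ) + 1 := Nat.lt_floor_add_one _
      have h53 : (53 : ℝ) * ((ρ - 23 - K) / 53) = ρ - 23 - K := by field_simp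
      have hm53 : 53 * (m : ℝ) ≤ ρ - 23 - K := by
        have := mul_le_mul_of_nonneg_left hmle (by norm_num : (0 : ℝ) ≤ 53)
        linarith
      have hm : 2 * (37 * (m : ℝ)) ^ 2 ≤ (ρ - 23 - K) ^ 2 := by
        have h0 : (0 : ℝ) ≤ 53 * (m : ℝ) := by positivity
        have h1 : (53 * (m : ℝ)) ^ 2 ≤ (ρ - 23 - K) ^ 2 := pow_le_pow_left₀ h0 hm53 2
        nlinarith
      have hcount := card_chainPayers_ge_sf hg hc X hX A₁ t₁ A₂ t₂ P₁ P₂ 20 h ρ (by norm_num) hρ hh hP₁X hP₂X'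
        (fun p hp => (hcell p hp).2.1) hP₁ hP₂ 𝓣 hA₁ hT hTh hδ₀ hδ K hK (by linarith) m hm
      change (2 * m + 1) ^ 2 ≤ (169 * K + 170) * PAY.card at hcount
      have hcount' : ((2 * (m : ℝ) + 1)) ^ 2 ≤ (169 * (K : ℝ) + 170) * (PAY.card : ℝ) := by
        exact_mod_cast hcount
      -- `2ρ − 99 − 2K ≤ 53 (2m + 1)`
      have hL0 : (0 : ℝ) ≤ 2 * ρ - 99 - 2 * K := by linarith
      have hLm : 2 * ρ - 99 - 2 * K ≤ 53 * (2 * (m : ℝ) + 1) := by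
        have := mul_lt_mul_of_pos_left hmlt (by norm_num : (0 : ℝ) < 53)
        rw [h53] at this
        linarith
      have hL2 : (2 * ρ - 99 - 2 * K) ^ 2 ≤ 2809 * ((169 * (K : ℝ) + 170) * (PAY.card : ℝ)) := by
        have h1 : (2 * ρ - 99 - 2 * K) ^ 2 ≤ (53 * (2 * (m : ℝ) + 1)) ^ 2 := pow_le_pow_left₀ hL0 hLm 2
        have h2 : (53 * (2 * (m : ℝ) + 1)) ^ 2 = 2809 * (2 * (m : ℝ) + 1) ^ 2 := by ring
        rw [h2] at h1
        exact h1.trans (mul_le_mul_of_nonneg_left hcount' (by norm_num))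
      -- `(169K + 170)·δ₀ ≤ 10986(1 + h)`
      have hu : (169 * (K : ℝ) + 170) * δ₀ ≤ 10986 * (1 + h) := by
        have e1 : (169 * (K : ℝ) + 170) * δ₀ = 169 * ((K : ℝ) * δ₀) + 170 * δ₀ := by ring
        rw [e1]; linarith
      -- `δ₀ (2ρ − 99 − 2K)² ≤ 2809 · 10986 (1+h) · #PAY`
      have hmain : δ₀ * (2 * ρ - 99 - 2 * K) ^ 2 ≤ 2809 * ((10986 * (1 + h)) * (PAY.card : ℝ)) := by
        have h1 := mul_le_mul_of_nonneg_left hL2 hδ₀.le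
        have h2 : δ₀ * (2809 * ((169 * (K : ℝ) + 170) * (PAY.card : ℝ))) =
            2809 * (((169 * (K : ℝ) + 170) * δ₀) * (PAY.card : ℝ)) := by ring
        rw [h2] at h1
        have h3 := mul_le_mul_of_nonneg_right hu hP0
        exact h1.trans (mul_le_mul_of_nonneg_left h3 (by norm_num))
      -- expand the square
      have hsq : δ₀ * (4 * ρ ^ 2) ≤ δ₀ * (2 * ρ - 99 - 2 * K) ^ 2 + δ₀ * (4 * ρ * (99 + 2 * K)) := by
        have e1 : (2 * ρ - 99 - 2 * (K : ℝ)) ^ 2 + 4 * ρ * (99 + 2 * K) = 4 * ρ ^ 2 + (99 + 2 * K) ^ 2 := by ring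
        have h1 : 4 * ρ ^ 2 ≤ (2 * ρ - 99 - 2 * K) ^ 2 + 4 * ρ * (99 + 2 * K) := by
          rw [e1]; nlinarith [sq_nonneg (99 + 2 * (K : ℝ))]
        have := mul_le_mul_of_nonneg_left h1 hδ₀.le
        rw [mul_add] at this; exact this
      have hlin : δ₀ * (4 * ρ * (99 + 2 * K)) ≤ 4 * ρ * (2 * h + 227) := by
        have h1 : δ₀ * (99 + 2 * (K : ℝ)) ≤ 2 * h + 227 := by
          have e1 : δ₀ * (99 + 2 * (K : ℝ)) = 99 * δ₀ + 2 * ((K : ℝ) * δ₀) := by ring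
          rw [e1]; linarith
        have h2 : (0 : ℝ) ≤ 4 * ρ := by positivity
        have e2 : δ₀ * (4 * ρ * (99 + 2 * (K : ℝ))) = (4 * ρ) * (δ₀ * (99 + 2 * K)) := by ring
        rw [e2]; exact mul_le_mul_of_nonneg_left h1 h2
      have hfin : δ₀ * (4 * ρ ^ 2) ≤ 2809 * ((10986 * (1 + h)) * (PAY.card : ℝ)) + 4 * ρ * (2 * h + 227) := by
        linarith
      have e3 : 2809 * ((10986 * (1 + h)) * (PAY.card : ℝ)) = 30859674 * ((1 + h) * (PAY.card : ℝ)) := by ring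
      have e4 : 4 * ρ * (2 * h + 227) = 8 * (h * ρ) + 908 * ρ := by ring
      rw [e3, e4] at hfin
      linarith
    · push Not at hρK
      have h1 : δ₀ * ρ ≤ h + 114 := by
        have := mul_le_mul_of_nonneg_left hρK.le hδ₀.le
        have e1 : δ₀ * ((K : ℝ) + 50) = (K : ℝ) * δ₀ + 50 * δ₀ := by ring
        rw [e1] at this; linarith
      have h2 : δ₀ * ρ ^ 2 ≤ (h + 114) * ρ := by
        have e1 : δ₀ * ρ ^ 2 = (δ₀ * ρ) * ρ := by ring
        rw [e1]; exact mul_le_mul_of_nonneg_right h1 hρ0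
      have e2 : (h + 114) * ρ = h * ρ + 114 * ρ := by ring
      rw [e2] at h2
      linarith
  -- the two upper slab counts and the two splits
  have hD₁ := hC₁ (-(2 * 20)) (-20) (by ring) ρ hρ P₁ hP₁
  have hD₂ := hC₂ (h + 20) (h + 2 * 20) (by ring) ρ hρ P₂ hP₂
  have hsplit₁ := contactDeficiency_sdiff_split hP₁X
  have hsplit₂ := contactDeficiency_sdiff_split hP₂X
  have htwo := two_mul_contactDeficiency_eq_sum X
  -- constants
  have hb : C₁ * ρ ≤ |C₁| * (1 + h) * ρ := by
    have h1 : 0 ≤ (|C₁| - C₁) * ρ := mul_nonneg (by linarith only [le_abs_self C₁]) hρ0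
    have h2 : 0 ≤ |C₁| * h * ρ := by positivity
    linarith only [h1, h2]
  have hc' : C₂ * ρ ≤ |C₂| * (1 + h) * ρ := by
    have h1 : 0 ≤ (|C₂| - C₂) * ρ := mul_nonneg (by linarith only [le_abs_self C₂]) hρ0
    have h2 : 0 ≤ |C₂| * h * ρ := by positivity
    linarith only [h1, h2]
  have hhρ : 0 ≤ h * ρ := mul_nonneg hh hρ0
  linarith only [hled, hcharge, hD₁, hD₂, hsplit₁, hsplit₂, htwo, hb, hc', hρ0, hh, hhρ]

end Summit.Ventures.Crystal3D.Theorems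

end
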